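import Summits.AtomisticToContinuum.Crystallization.Theorems.ChartedPlanarOrderPairModulusTail

/-!
# The certificate leaves SPLIT BY LAYER TYPE: triangular (T) / square (S) branch (decomp-a2c lens-3 g24, task (z2))

lens-4 g33 («CellNormalForm», slot 7d) observed that the zero-pressure fcc crystal PRESENTED ON ITS {100} SQUARE LAYERS (`a ⊥ b`,
`‖a‖ = ‖b‖ = d⋆ ≈ 0.971`, 4-fold-hollow registry, spacing `h⋆ ≈ 0.687`) satisfies every W′ binder; (n) `…StackedUniform.stackedUniform` had
already PROVED that the clean stacked window is the EXHAUSTIVE dichotomy T `95/289·‖a‖² ≤ |⟪a, b⟫|` (triangular layers) ∣ S `|⟪a, b⟫| ≤ 11/75·‖a‖²`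
(square layers).  The certificate leaves of (x)/(y) (`AdjacentChannel…`, `FarChannelBelow…`) carry ONE set of constants for both branches, while the
explicit lattice sums — hence the census numbers (TAG 161b: T branch only) and the certificates — DIFFER per branch.  This file types the leaves PER
BRANCH and glues them, per configuration, through (n)'s disjunction; the analytic power-law tail ((z) `PowerPairModulusW'/Ref … K`) is common.

* §1 W′: `AdjacentChannelW'T/W'S Λ ρ λ_T λ_N`, `FarChannelBelowW'T/W'S Λ ρ μ_T μ_N s₀` (the leaf binder lists + the branch inequality) and
  ★★ `tubeChannelsW'_of_branches : Λ ≤ 17/16 → 0 ≤ K → PowerPairModulusW' Λ ρ K → (T leaves + T arithmetic) → (S leaves + S arithmetic) →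
  TubeChannelsW' Λ ρ`; OF RECORD `tubeConvexW'_record_of_branch_certs : … → TubeConvexW' (17/16) (1/40)` (parametric in `K`).
* §2 Ref twins `AdjacentChannelRefT/RefS`, `FarChannelBelowRefT/RefS`, ★★ `tubeChannelsRef_of_branches`, `tubeConvexRef_record_of_branch_certs`.
* the forgetful seams `adjacentChannelW'T_of_W'`, `…W'S_of_W'`, `farChannelBelowW'T_of_W'`, `…W'S_of_W'` (branch leaves are WEAKER-or-equal).

All proofs binder plumbing + one case split; sorry-free, standard axioms; no instances, no notation.
-/

noncomputable section

namespace Summit.AtomisticToContinuum.Crystallization.Theorems.ChartedPlanarOrderTubeChannelsTS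

open Finset
open scoped RealInnerProductSpace
open Summit.AtomisticToContinuum.Crystallization.Theorems.ChartedPlanarOrderChunkFloor (E3)
open Summit.AtomisticToContinuum.Crystallization.Theorems.ChartedPlanarOrderProfileSlavingLJ (IsStacked gapStress incr)
open Summit.AtomisticToContinuum.Crystallization.Theorems.OverbindingBudgetElasticSplitShear (StressFree)
open Summit.AtomisticToContinuum.Crystallization.Theorems.ChartedPlanarOrderRigidityDoor (IsNash)
open Summit.AtomisticToContinuum.Crystallization.Theorems.ChartedPlanarOrderDensityDichotomy (μS IsSep)
open Summit.AtomisticToContinuum.Crystallization.Theorems.ChartedPlanarOrderDoorLayered (Layered)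
open Summit.AtomisticToContinuum.Crystallization.Theorems.OverbindingBudgetScaleWidening (IsCleanW)
open Summit.AtomisticToContinuum.Crystallization.Theorems.OverbindingBudgetPeriodicCleanOrStrained (UniformlyClean)
open Summit.AtomisticToContinuum.Crystallization.Theorems.ChartedPlanarOrderStackedUniform (stackedUniform)
open Summit.AtomisticToContinuum.Crystallization.Theorems.ChartedPlanarOrderCleanScaleP (cleanStackedIndependentW)
open Summit.AtomisticToContinuum.Crystallization.Theorems.ChartedPlanarOrderTubeConvex (TubeConvexW' TubeConvexRef)
open Summit.AtomisticToContinuum.Crystallization.Theorems.ChartedPlanarOrderTubeChannels (IsAdjacentChannelMono IsFarChannelModulusBelow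
  tubeChannelData_of_certs exists_unit_normal TubeChannelsW' AdjacentChannelW' FarChannelBelowW' tubeConvexW'_record_of_channels)
open Summit.AtomisticToContinuum.Crystallization.Theorems.ChartedPlanarOrderTubeChannelsRef (TubeChannelsRef AdjacentChannelRef FarChannelBelowRef
  tubeConvexRef_record_of_channels)
open Summit.AtomisticToContinuum.Crystallization.Theorems.ChartedPlanarOrderPairModulusTail (PowerPairModulusW' PowerPairModulusRef
  sum_Ico_sq_mul_power_le)

/-! ## §1 W′ level -/

/-- ★ LEAF CHᴬ-W′-T · adjacent channel monotonicity on the TRIANGULAR branch `95/289·‖a‖² ≤ |⟪a, b⟫|`. [CERT · ONE lattice sum · T registry] -/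
def AdjacentChannelW'T (Λ ρ lT lN : ℝ) : Prop :=
  ∀ δ : ℝ, 0 < δ → ∀ (a b : E3) (w : ℤ → E3), ‖a‖ ≤ Λ → ‖b‖ ≤ Λ →
    IsSep δ (Layered a b w) → IsCleanW (μS (Layered a b w)) → IsNash (μS (Layered a b w)) → IsStacked a b w →
    StressFree (Layered a b w) → (∀ m : ℤ, gapStress a b m (incr w) = 0) → 95 / 289 * ‖a‖ ^ 2 ≤ |⟪a, b⟫| →
    ∀ ν : E3, ‖ν‖ = 1 → ⟪ν, a⟫ = 0 → ⟪ν, b⟫ = 0 → IsAdjacentChannelMono a b w ρ ν lT lN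

/-- ★ LEAF CHᴬ-W′-S · adjacent channel monotonicity on the SQUARE branch `|⟪a, b⟫| ≤ 11/75·‖a‖²` (fcc on {100}). [CERT · ONE lattice sum · 4-fold hollow] -/
def AdjacentChannelW'S (Λ ρ lT lN : ℝ) : Prop :=
  ∀ δ : ℝ, 0 < δ → ∀ (a b : E3) (w : ℤ → E3), ‖a‖ ≤ Λ → ‖b‖ ≤ Λ →
    IsSep δ (Layered a b w) → IsCleanW (μS (Layered a b w)) → IsNash (μS (Layered a b w)) → IsStacked a b w →
    StressFree (Layered a b w) → (∀ m : ℤ, gapStress a b m (incr w) = 0) → |⟪a, b⟫| ≤ 11 / 75 * ‖a‖ ^ 2 →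
    ∀ ν : E3, ‖ν‖ = 1 → ⟪ν, a⟫ = 0 → ⟪ν, b⟫ = 0 → IsAdjacentChannelMono a b w ρ ν lT lN

/-- ★ LEAF CHꜰ-W′-T below `s₀` on the triangular branch. [CERT · `s₀ − 2` lattice sums] -/
def FarChannelBelowW'T (Λ ρ : ℝ) (μT μN : ℕ → ℝ) (s₀ : ℕ) : Prop :=
  ∀ δ : ℝ, 0 < δ → ∀ (a b : E3) (w : ℤ → E3), ‖a‖ ≤ Λ → ‖b‖ ≤ Λ →
    IsSep δ (Layered a b w) → IsCleanW (μS (Layered a b w)) → IsNash (μS (Layered a b w)) → IsStacked a b w →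
    StressFree (Layered a b w) → (∀ m : ℤ, gapStress a b m (incr w) = 0) → 95 / 289 * ‖a‖ ^ 2 ≤ |⟪a, b⟫| →
    ∀ ν : E3, ‖ν‖ = 1 → ⟪ν, a⟫ = 0 → ⟪ν, b⟫ = 0 → IsFarChannelModulusBelow a b w ρ ν μT μN s₀

/-- ★ LEAF CHꜰ-W′-S below `s₀` on the square branch. [CERT · `s₀ − 2` lattice sums] -/
def FarChannelBelowW'S (Λ ρ : ℝ) (μT μN : ℕ → ℝ) (s₀ : ℕ) : Prop :=
  ∀ δ : ℝ, 0 < δ → ∀ (a b : E3) (w : ℤ → E3), ‖a‖ ≤ Λ → ‖b‖ ≤ Λ →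
    IsSep δ (Layered a b w) → IsCleanW (μS (Layered a b w)) → IsNash (μS (Layered a b w)) → IsStacked a b w →
    StressFree (Layered a b w) → (∀ m : ℤ, gapStress a b m (incr w) = 0) → |⟪a, b⟫| ≤ 11 / 75 * ‖a‖ ^ 2 →
    ∀ ν : E3, ‖ν‖ = 1 → ⟪ν, a⟫ = 0 → ⟪ν, b⟫ = 0 → IsFarChannelModulusBelow a b w ρ ν μT μN s₀

/-- forgetful seam: the branch-free leaf gives the T leaf. -/
theorem adjacentChannelW'T_of_W' {Λ ρ lT lN : ℝ} (h : AdjacentChannelW' Λ ρ lT lN) : AdjacentChannelW'T Λ ρ lT lN :=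
  fun δ hδ a b w ha hb hs hc hn hst hf hz _ => h δ hδ a b w ha hb hs hc hn hst hf hz

/-- forgetful seam: the branch-free leaf gives the S leaf. -/
theorem adjacentChannelW'S_of_W' {Λ ρ lT lN : ℝ} (h : AdjacentChannelW' Λ ρ lT lN) : AdjacentChannelW'S Λ ρ lT lN :=
  fun δ hδ a b w ha hb hs hc hn hst hf hz _ => h δ hδ a b w ha hb hs hc hn hst hf hz

/-- Auxiliary channel bookkeeping (`farChannelBelowW'T_of_W'`). [folklore] -/
theorem farChannelBelowW'T_of_W' {Λ ρ : ℝ} {μT μN : ℕ → ℝ} {s₀ : ℕ} (h : FarChannelBelowW' Λ ρ μT μN s₀) :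
    FarChannelBelowW'T Λ ρ μT μN s₀ :=
  fun δ hδ a b w ha hb hs hc hn hst hf hz _ => h δ hδ a b w ha hb hs hc hn hst hf hz

/-- Auxiliary channel bookkeeping (`farChannelBelowW'S_of_W'`). [folklore] -/
theorem farChannelBelowW'S_of_W' {Λ ρ : ℝ} {μT μN : ℕ → ℝ} {s₀ : ℕ} (h : FarChannelBelowW' Λ ρ μT μN s₀) :
    FarChannelBelowW'S Λ ρ μT μN s₀ :=
  fun δ hδ a b w ha hb hs hc hn hst hf hz _ => h δ hδ a b w ha hb hs hc hn hst hf hz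

/-- ★★ glue PER BRANCH: T leaves with their arithmetic, S leaves with theirs, one common power-law tail `K s⁻⁶` ⇒ CH `TubeChannelsW' Λ ρ`
(`Λ ≤ 17/16`: the configuration is put in its branch by `stackedUniform`). -/
theorem tubeChannelsW'_of_branches {Λ ρ K : ℝ} (hΛ : Λ ≤ 17 / 16) (hK : 0 ≤ K) (hP : PowerPairModulusW' Λ ρ K)
    {lT lN lam B₁T B₁N : ℝ} {μT μN : ℕ → ℝ} {s₀ : ℕ}
    (hAT : AdjacentChannelW'T Λ ρ lT lN) (hBT : FarChannelBelowW'T Λ ρ μT μN s₀) (hs₀ : 2 ≤ s₀) (hμT : ∀ s, 0 ≤ μT s) (hμN : ∀ s, 0 ≤ μN s)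
    (h₁T : ∑ s ∈ Finset.Ico 2 s₀, ((s : ℕ) : ℝ) ^ 2 * μT s ≤ B₁T) (h₁N : ∑ s ∈ Finset.Ico 2 s₀, ((s : ℕ) : ℝ) ^ 2 * μN s ≤ B₁N)
    (hlam : 0 < lam) (hlamT : lam + (B₁T + K / (3 * (((s₀ : ℕ) : ℝ) - 1) ^ 3)) ≤ lT)
    (hlamN : lam + (B₁N + K / (3 * (((s₀ : ℕ) : ℝ) - 1) ^ 3)) ≤ lN)
    {lT' lN' lam' B₁T' B₁N' : ℝ} {μT' μN' : ℕ → ℝ} {s₀' : ℕ}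
    (hAS : AdjacentChannelW'S Λ ρ lT' lN') (hBS : FarChannelBelowW'S Λ ρ μT' μN' s₀') (hs₀' : 2 ≤ s₀') (hμT' : ∀ s, 0 ≤ μT' s)
    (hμN' : ∀ s, 0 ≤ μN' s) (h₁T' : ∑ s ∈ Finset.Ico 2 s₀', ((s : ℕ) : ℝ) ^ 2 * μT' s ≤ B₁T')
    (h₁N' : ∑ s ∈ Finset.Ico 2 s₀', ((s : ℕ) : ℝ) ^ 2 * μN' s ≤ B₁N') (hlam' : 0 < lam')
    (hlamT' : lam' + (B₁T' + K / (3 * (((s₀' : ℕ) : ℝ) - 1) ^ 3)) ≤ lT') (hlamN' : lam' + (B₁N' + K / (3 * (((s₀' : ℕ) : ℝ) - 1) ^ 3)) ≤ lN') :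
    TubeChannelsW' Λ ρ := by
  intro δ hδ a b w ha hb hs hc hn hst hf hz
  obtain ⟨ν, hν, hνa, hνb⟩ := exists_unit_normal (cleanStackedIndependentW δ hδ a b w hs hc hst)
  have hPM := hP δ hδ a b w ha hb hs hc hn hst hf hz
  have hτ : ∀ s : ℕ, 0 ≤ K * ((s : ℕ) : ℝ)⁻¹ ^ 6 := fun s => by positivity
  obtain ⟨ν₀, -, -, -, -, -, -, -, hTS⟩ := stackedUniform (aHi := 103 / 100) (by norm_num) hδ hs hc hst (ha.trans hΛ) (hb.trans hΛ)
  rcases hTS with ⟨hT, -⟩ | ⟨hS, -⟩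
  · exact tubeChannelData_of_certs hν (hAT δ hδ a b w ha hb hs hc hn hst hf hz hT ν hν hνa hνb)
      (hBT δ hδ a b w ha hb hs hc hn hst hf hz hT ν hν hνa hνb) hPM hμT hμN hτ h₁T h₁N (fun N => sum_Ico_sq_mul_power_le hK hs₀ N) hlam
      hlamT hlamN
  · exact tubeChannelData_of_certs hν (hAS δ hδ a b w ha hb hs hc hn hst hf hz hS ν hν hνa hνb)
      (hBS δ hδ a b w ha hb hs hc hn hst hf hz hS ν hν hνa hνb) hPM hμT' hμN' hτ h₁T' h₁N' (fun N => sum_Ico_sq_mul_power_le hK hs₀' N) hlam'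
      hlamT' hlamN'

/-- ★★ OF RECORD: slot 7c′ `TubeConvexW' (17/16) (1/40)` from the T certificates + T arithmetic, the S certificates + S arithmetic and one power
constant `K` (parametric). -/
theorem tubeConvexW'_record_of_branch_certs {K : ℝ} (hK : 0 ≤ K) (hP : PowerPairModulusW' (17 / 16) (1 / 40) K)
    {lT lN lam B₁T B₁N : ℝ} {μT μN : ℕ → ℝ} {s₀ : ℕ}
    (hAT : AdjacentChannelW'T (17 / 16) (1 / 40) lT lN) (hBT : FarChannelBelowW'T (17 / 16) (1 / 40) μT μN s₀) (hs₀ : 2 ≤ s₀)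
    (hμT : ∀ s, 0 ≤ μT s) (hμN : ∀ s, 0 ≤ μN s)
    (h₁T : ∑ s ∈ Finset.Ico 2 s₀, ((s : ℕ) : ℝ) ^ 2 * μT s ≤ B₁T) (h₁N : ∑ s ∈ Finset.Ico 2 s₀, ((s : ℕ) : ℝ) ^ 2 * μN s ≤ B₁N)
    (hlam : 0 < lam) (hlamT : lam + (B₁T + K / (3 * (((s₀ : ℕ) : ℝ) - 1) ^ 3)) ≤ lT)
    (hlamN : lam + (B₁N + K / (3 * (((s₀ : ℕ) : ℝ) - 1) ^ 3)) ≤ lN)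
    {lT' lN' lam' B₁T' B₁N' : ℝ} {μT' μN' : ℕ → ℝ} {s₀' : ℕ}
    (hAS : AdjacentChannelW'S (17 / 16) (1 / 40) lT' lN') (hBS : FarChannelBelowW'S (17 / 16) (1 / 40) μT' μN' s₀') (hs₀' : 2 ≤ s₀')
    (hμT' : ∀ s, 0 ≤ μT' s) (hμN' : ∀ s, 0 ≤ μN' s) (h₁T' : ∑ s ∈ Finset.Ico 2 s₀', ((s : ℕ) : ℝ) ^ 2 * μT' s ≤ B₁T')
    (h₁N' : ∑ s ∈ Finset.Ico 2 s₀', ((s : ℕ) : ℝ) ^ 2 * μN' s ≤ B₁N') (hlam' : 0 < lam')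
    (hlamT' : lam' + (B₁T' + K / (3 * (((s₀' : ℕ) : ℝ) - 1) ^ 3)) ≤ lT') (hlamN' : lam' + (B₁N' + K / (3 * (((s₀' : ℕ) : ℝ) - 1) ^ 3)) ≤ lN') :
    TubeConvexW' (17 / 16) (1 / 40) :=
  tubeConvexW'_record_of_channels (tubeChannelsW'_of_branches le_rfl hK hP hAT hBT hs₀ hμT hμN h₁T h₁N hlam hlamT hlamN hAS hBS hs₀' hμT'
    hμN' h₁T' h₁N' hlam' hlamT' hlamN')

/-! ## §2 Ref level -/

/-- ★ LEAF CHᴬ-Ref-T. -/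
def AdjacentChannelRefT (Λ₁ ρ lT lN : ℝ) : Prop :=
  ∀ δ : ℝ, 0 < δ → ∀ (a b : E3) (w' : ℤ → E3), IsStacked a b w' → LinearIndependent ℝ ![a, b] → ‖a‖ ≤ Λ₁ → ‖b‖ ≤ Λ₁ →
    IsSep δ (Layered a b w') → IsCleanW (μS (Layered a b w')) → (∀ m : ℤ, gapStress a b m (incr w') = 0) →
    UniformlyClean (Layered a b w') → 95 / 289 * ‖a‖ ^ 2 ≤ |⟪a, b⟫| →
    ∀ ν : E3, ‖ν‖ = 1 → ⟪ν, a⟫ = 0 → ⟪ν, b⟫ = 0 → IsAdjacentChannelMono a b w' ρ ν lT lN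

/-- ★ LEAF CHᴬ-Ref-S. -/
def AdjacentChannelRefS (Λ₁ ρ lT lN : ℝ) : Prop :=
  ∀ δ : ℝ, 0 < δ → ∀ (a b : E3) (w' : ℤ → E3), IsStacked a b w' → LinearIndependent ℝ ![a, b] → ‖a‖ ≤ Λ₁ → ‖b‖ ≤ Λ₁ →
    IsSep δ (Layered a b w') → IsCleanW (μS (Layered a b w')) → (∀ m : ℤ, gapStress a b m (incr w') = 0) →
    UniformlyClean (Layered a b w') → |⟪a, b⟫| ≤ 11 / 75 * ‖a‖ ^ 2 →
    ∀ ν : E3, ‖ν‖ = 1 → ⟪ν, a⟫ = 0 → ⟪ν, b⟫ = 0 → IsAdjacentChannelMono a b w' ρ ν lT lN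

/-- ★ LEAF CHꜰ-Ref-T below `s₀`. -/
def FarChannelBelowRefT (Λ₁ ρ : ℝ) (μT μN : ℕ → ℝ) (s₀ : ℕ) : Prop :=
  ∀ δ : ℝ, 0 < δ → ∀ (a b : E3) (w' : ℤ → E3), IsStacked a b w' → LinearIndependent ℝ ![a, b] → ‖a‖ ≤ Λ₁ → ‖b‖ ≤ Λ₁ →
    IsSep δ (Layered a b w') → IsCleanW (μS (Layered a b w')) → (∀ m : ℤ, gapStress a b m (incr w') = 0) →
    UniformlyClean (Layered a b w') → 95 / 289 * ‖a‖ ^ 2 ≤ |⟪a, b⟫| →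
    ∀ ν : E3, ‖ν‖ = 1 → ⟪ν, a⟫ = 0 → ⟪ν, b⟫ = 0 → IsFarChannelModulusBelow a b w' ρ ν μT μN s₀

/-- ★ LEAF CHꜰ-Ref-S below `s₀`. -/
def FarChannelBelowRefS (Λ₁ ρ : ℝ) (μT μN : ℕ → ℝ) (s₀ : ℕ) : Prop :=
  ∀ δ : ℝ, 0 < δ → ∀ (a b : E3) (w' : ℤ → E3), IsStacked a b w' → LinearIndependent ℝ ![a, b] → ‖a‖ ≤ Λ₁ → ‖b‖ ≤ Λ₁ →
    IsSep δ (Layered a b w') → IsCleanW (μS (Layered a b w')) → (∀ m : ℤ, gapStress a b m (incr w') = 0) →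
    UniformlyClean (Layered a b w') → |⟪a, b⟫| ≤ 11 / 75 * ‖a‖ ^ 2 →
    ∀ ν : E3, ‖ν‖ = 1 → ⟪ν, a⟫ = 0 → ⟪ν, b⟫ = 0 → IsFarChannelModulusBelow a b w' ρ ν μT μN s₀

/-- Auxiliary channel bookkeeping (`adjacentChannelRefT_of_Ref`). [folklore] -/
theorem adjacentChannelRefT_of_Ref {Λ₁ ρ lT lN : ℝ} (h : AdjacentChannelRef Λ₁ ρ lT lN) : AdjacentChannelRefT Λ₁ ρ lT lN :=
  fun δ hδ a b w' hst hab ha hb hs hc hz hUC _ => h δ hδ a b w' hst hab ha hb hs hc hz hUC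

/-- Auxiliary channel bookkeeping (`adjacentChannelRefS_of_Ref`). [folklore] -/
theorem adjacentChannelRefS_of_Ref {Λ₁ ρ lT lN : ℝ} (h : AdjacentChannelRef Λ₁ ρ lT lN) : AdjacentChannelRefS Λ₁ ρ lT lN :=
  fun δ hδ a b w' hst hab ha hb hs hc hz hUC _ => h δ hδ a b w' hst hab ha hb hs hc hz hUC

/-- Auxiliary channel bookkeeping (`farChannelBelowRefT_of_Ref`). [folklore] -/
theorem farChannelBelowRefT_of_Ref {Λ₁ ρ : ℝ} {μT μN : ℕ → ℝ} {s₀ : ℕ} (h : FarChannelBelowRef Λ₁ ρ μT μN s₀) :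
    FarChannelBelowRefT Λ₁ ρ μT μN s₀ :=
  fun δ hδ a b w' hst hab ha hb hs hc hz hUC _ => h δ hδ a b w' hst hab ha hb hs hc hz hUC

/-- Auxiliary channel bookkeeping (`farChannelBelowRefS_of_Ref`). [folklore] -/
theorem farChannelBelowRefS_of_Ref {Λ₁ ρ : ℝ} {μT μN : ℕ → ℝ} {s₀ : ℕ} (h : FarChannelBelowRef Λ₁ ρ μT μN s₀) :
    FarChannelBelowRefS Λ₁ ρ μT μN s₀ :=
  fun δ hδ a b w' hst hab ha hb hs hc hz hUC _ => h δ hδ a b w' hst hab ha hb hs hc hz hUC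

/-- ★★ glue PER BRANCH in the Ref currency ⇒ CH-Ref `TubeChannelsRef Λ₁ ρ` (`Λ₁ ≤ 17/16`). -/
theorem tubeChannelsRef_of_branches {Λ₁ ρ K : ℝ} (hΛ : Λ₁ ≤ 17 / 16) (hK : 0 ≤ K) (hP : PowerPairModulusRef Λ₁ ρ K)
    {lT lN lam B₁T B₁N : ℝ} {μT μN : ℕ → ℝ} {s₀ : ℕ}
    (hAT : AdjacentChannelRefT Λ₁ ρ lT lN) (hBT : FarChannelBelowRefT Λ₁ ρ μT μN s₀) (hs₀ : 2 ≤ s₀) (hμT : ∀ s, 0 ≤ μT s)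
    (hμN : ∀ s, 0 ≤ μN s) (h₁T : ∑ s ∈ Finset.Ico 2 s₀, ((s : ℕ) : ℝ) ^ 2 * μT s ≤ B₁T)
    (h₁N : ∑ s ∈ Finset.Ico 2 s₀, ((s : ℕ) : ℝ) ^ 2 * μN s ≤ B₁N) (hlam : 0 < lam)
    (hlamT : lam + (B₁T + K / (3 * (((s₀ : ℕ) : ℝ) - 1) ^ 3)) ≤ lT) (hlamN : lam + (B₁N + K / (3 * (((s₀ : ℕ) : ℝ) - 1) ^ 3)) ≤ lN)
    {lT' lN' lam' B₁T' B₁N' : ℝ} {μT' μN' : ℕ → ℝ} {s₀' : ℕ}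
    (hAS : AdjacentChannelRefS Λ₁ ρ lT' lN') (hBS : FarChannelBelowRefS Λ₁ ρ μT' μN' s₀') (hs₀' : 2 ≤ s₀') (hμT' : ∀ s, 0 ≤ μT' s)
    (hμN' : ∀ s, 0 ≤ μN' s) (h₁T' : ∑ s ∈ Finset.Ico 2 s₀', ((s : ℕ) : ℝ) ^ 2 * μT' s ≤ B₁T')
    (h₁N' : ∑ s ∈ Finset.Ico 2 s₀', ((s : ℕ) : ℝ) ^ 2 * μN' s ≤ B₁N') (hlam' : 0 < lam')
    (hlamT' : lam' + (B₁T' + K / (3 * (((s₀' : ℕ) : ℝ) - 1) ^ 3)) ≤ lT') (hlamN' : lam' + (B₁N' + K / (3 * (((s₀' : ℕ) : ℝ) - 1) ^ 3)) ≤ lN') :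
    TubeChannelsRef Λ₁ ρ := by
  intro δ hδ a b w' hst hab ha hb hs hc hz hUC
  obtain ⟨ν, hν, hνa, hνb⟩ := exists_unit_normal hab
  have hPM := hP δ hδ a b w' hst hab ha hb hs hc hz hUC
  have hτ : ∀ s : ℕ, 0 ≤ K * ((s : ℕ) : ℝ)⁻¹ ^ 6 := fun s => by positivity
  obtain ⟨ν₀, -, -, -, -, -, -, -, hTS⟩ := stackedUniform (aHi := 103 / 100) (by norm_num) hδ hs hc hst (ha.trans hΛ) (hb.trans hΛ)
  rcases hTS with ⟨hT, -⟩ | ⟨hS, -⟩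
  · exact tubeChannelData_of_certs hν (hAT δ hδ a b w' hst hab ha hb hs hc hz hUC hT ν hν hνa hνb)
      (hBT δ hδ a b w' hst hab ha hb hs hc hz hUC hT ν hν hνa hνb) hPM hμT hμN hτ h₁T h₁N (fun N => sum_Ico_sq_mul_power_le hK hs₀ N) hlam
      hlamT hlamN
  · exact tubeChannelData_of_certs hν (hAS δ hδ a b w' hst hab ha hb hs hc hz hUC hS ν hν hνa hνb)
      (hBS δ hδ a b w' hst hab ha hb hs hc hz hUC hS ν hν hνa hνb) hPM hμT' hμN' hτ h₁T' h₁N' (fun N => sum_Ico_sq_mul_power_le hK hs₀' N)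
      hlam' hlamT' hlamN'

/-- ★★ OF RECORD (Ref currency): 7c‴ `TubeConvexRef (17/16) (1/40)` from the per-branch certificates, per-branch arithmetic and one power constant. -/
theorem tubeConvexRef_record_of_branch_certs {K : ℝ} (hK : 0 ≤ K) (hP : PowerPairModulusRef (17 / 16) (1 / 40) K)
    {lT lN lam B₁T B₁N : ℝ} {μT μN : ℕ → ℝ} {s₀ : ℕ}
    (hAT : AdjacentChannelRefT (17 / 16) (1 / 40) lT lN) (hBT : FarChannelBelowRefT (17 / 16) (1 / 40) μT μN s₀) (hs₀ : 2 ≤ s₀)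
    (hμT : ∀ s, 0 ≤ μT s) (hμN : ∀ s, 0 ≤ μN s)
    (h₁T : ∑ s ∈ Finset.Ico 2 s₀, ((s : ℕ) : ℝ) ^ 2 * μT s ≤ B₁T) (h₁N : ∑ s ∈ Finset.Ico 2 s₀, ((s : ℕ) : ℝ) ^ 2 * μN s ≤ B₁N)
    (hlam : 0 < lam) (hlamT : lam + (B₁T + K / (3 * (((s₀ : ℕ) : ℝ) - 1) ^ 3)) ≤ lT)
    (hlamN : lam + (B₁N + K / (3 * (((s₀ : ℕ) : ℝ) - 1) ^ 3)) ≤ lN)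
    {lT' lN' lam' B₁T' B₁N' : ℝ} {μT' μN' : ℕ → ℝ} {s₀' : ℕ}
    (hAS : AdjacentChannelRefS (17 / 16) (1 / 40) lT' lN') (hBS : FarChannelBelowRefS (17 / 16) (1 / 40) μT' μN' s₀') (hs₀' : 2 ≤ s₀')
    (hμT' : ∀ s, 0 ≤ μT' s) (hμN' : ∀ s, 0 ≤ μN' s) (h₁T' : ∑ s ∈ Finset.Ico 2 s₀', ((s : ℕ) : ℝ) ^ 2 * μT' s ≤ B₁T')
    (h₁N' : ∑ s ∈ Finset.Ico 2 s₀', ((s : ℕ) : ℝ) ^ 2 * μN' s ≤ B₁N') (hlam' : 0 < lam')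
    (hlamT' : lam' + (B₁T' + K / (3 * (((s₀' : ℕ) : ℝ) - 1) ^ 3)) ≤ lT') (hlamN' : lam' + (B₁N' + K / (3 * (((s₀' : ℕ) : ℝ) - 1) ^ 3)) ≤ lN') :
    TubeConvexRef (17 / 16) (1 / 40) :=
  tubeConvexRef_record_of_channels (tubeChannelsRef_of_branches le_rfl hK hP hAT hBT hs₀ hμT hμN h₁T h₁N hlam hlamT hlamN hAS hBS hs₀' hμT'
    hμN' h₁T' h₁N' hlam' hlamT' hlamN')

end Summit.AtomisticToContinuum.Crystallization.Theorems.ChartedPlanarOrderTubeChannelsTS
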